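import Summits.AnomalousDissipation.AnomalousDissipation.Theorems.SawtoothPulseCascadeK1LocalisedCascadeCanonicalThinBlocks

/-!
# K1loc — helper: THE SLOW GEOMETRIC BLOCK FAMILY `Λ_m = ⌊Λ₀(9/8)^m⌋` FOR THE THIN RATIO WINDOWS (arithmetic layer)

Helper file of the prover lane on the crux `K1LocalisedCascade` (stmt-AnomalousDissipation-19491), route `SawtoothPulseCascade`
(S-B/S-C assembly seat; the LEDGER ASSEMBLY, thin tail).  In the thin phases the RATIO windows (O-V), (C-H) of `…RatioBlocksOsc` have
class slope `v/u` with margin `μ = uG − v` a few percent of `uG` (class `16|k₀| ≤ 125|k₁|`: `μ = 3`, `μ/u = 0.1875`) and feed cut-offs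
`Q₁^m = ⌊u′Λ_{m+1}/v′⌋` with `u′/v′ ≈ 0.128…0.134`: the fibre blocks can NEVER double (`(u′/v′)Λ_{m+1} < θ(μ/u)Λ_m` forces
`Λ_{m+1}/Λ_m < 1.46`).  This file is the arithmetic of the family `Λ_m = ⌊Λ₀·9^m/8^m⌋` (natural division), window tops
`Q₂^m = ⌊θ_nμΛ_m/(θ_du)⌋`:
* §1 the family: `thinR_blocks_monotone`, `thinR_blocks_ge` (`Λ_m ≥ Λ₀`), `thinR_blocks_succ_le` (`8Λ_{m+1} ≤ 9Λ_m + 8`),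
  `thinR_blocks_real_le/_ge` (`Λ₀(9/8)^m − 1 ≤ Λ_m ≤ Λ₀(9/8)^m`), `thinR_blocks_ge_half_geom` (`Λ_m ≥ (Λ₀/2)(9/8)^m` for `Λ₀ ≥ 2`),
  `thinR_blocks_le_two_pow` (`Λ_m ≤ Λ₀2^m`);
* §2 cut-offs on every block from FOUR scalar facts (slope + base for separation and for the cut-off fraction): `thinR_shift`
  (`uQ₂^m < Λ_mμ`), `thinR_sep` (`Q₁^m < Q₂^m`), `thinR_frac` (`c_du′Λ_{m+1} ≤ c_nv′Q₂^m`), hence `thinR_r_le` via `thin_r_le`;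
* §3 uniform constants: `thinR_A_facts` (`1 ≤ A_m ≤ A* = ((v+uG)θ_d + θ_nμ)/((θ_d − θ_n)μ)`), `thinR_den_ge`
  (`D_m = (μΛ_m − uQ₂^m)/u ≥ ((θ_d−θ_n)μΛ₀/(2θ_du))·(9/8)^m`), in the exact shapes of the hypotheses of `…RatioBlocksOsc`.
Pure natural/real arithmetic; no definitions; no statement about the crux. [cite: Grafakos2014, Prop. 3.2.7 (3)] [problem: turb]
-/

-- `Summit.<Summit>.<Problem>`: single-conjunct summit, the duplicate namespace segment is deliberate.
set_option linter.dupNamespace false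

noncomputable section

namespace Summit.AnomalousDissipation.AnomalousDissipation.Theorems.SawtoothPulseCascade.K1Window

open Finset

/-! ## §1 The family `Λ_m = ⌊Λ₀·9^m/8^m⌋` -/

/-- `Λ_m ≤ Λ_{m+1}`: the family is monotone. [folklore] -/
theorem thinR_blocks_monotone (Λ0 : ℕ) : Monotone fun m : ℕ => Λ0 * 9 ^ m / 8 ^ m := by
  refine monotone_nat_of_le_succ fun m => ?_
  show Λ0 * 9 ^ m / 8 ^ m ≤ Λ0 * 9 ^ (m + 1) / 8 ^ (m + 1)
  have h8 : 0 < 8 ^ m := by positivity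
  calc Λ0 * 9 ^ m / 8 ^ m = 8 * (Λ0 * 9 ^ m) / (8 * 8 ^ m) := (Nat.mul_div_mul_left _ _ (by norm_num)).symm
    _ ≤ 9 * (Λ0 * 9 ^ m) / (8 * 8 ^ m) := Nat.div_le_div_right (Nat.mul_le_mul_right _ (by norm_num))
    _ = Λ0 * 9 ^ (m + 1) / 8 ^ (m + 1) := by rw [pow_succ, pow_succ]; ring_nf

/-- `Λ₀ ≤ Λ_m`. [folklore] -/
theorem thinR_blocks_ge (Λ0 m : ℕ) : Λ0 ≤ Λ0 * 9 ^ m / 8 ^ m := by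
  have h8 : 0 < 8 ^ m := by positivity
  calc Λ0 = Λ0 * 8 ^ m / 8 ^ m := (Nat.mul_div_cancel Λ0 h8).symm
    _ ≤ Λ0 * 9 ^ m / 8 ^ m := Nat.div_le_div_right (Nat.mul_le_mul_left _ (Nat.pow_le_pow_left (by norm_num) m))

/-- **Slow growth**: `8Λ_{m+1} ≤ 9Λ_m + 8`. [folklore] -/
theorem thinR_blocks_succ_le (Λ0 m : ℕ) : 8 * (Λ0 * 9 ^ (m + 1) / 8 ^ (m + 1)) ≤ 9 * (Λ0 * 9 ^ m / 8 ^ m) + 8 := by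
  set x := Λ0 * 9 ^ m with hx
  set y := 8 ^ m with hy
  have hy0 : 0 < y := by rw [hy]; positivity
  have e1 : Λ0 * 9 ^ (m + 1) / 8 ^ (m + 1) = 9 * x / y / 8 := by
    rw [pow_succ, pow_succ, ← mul_assoc, ← hx, ← hy, Nat.div_div_eq_div_mul]; ring_nf
  rw [e1]
  have h1 : 8 * (9 * x / y / 8) ≤ 9 * x / y := by rw [mul_comm]; exact Nat.div_mul_le_self _ _
  have h2 : 9 * x / y ≤ 9 * (x / y) + 8 := by
    have hmod : x % y < y := Nat.mod_lt _ hy0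
    have ex : 9 * x = 9 * (x % y) + 9 * (x / y) * y := by
      have := Nat.div_add_mod x y
      nlinarith [this]
    rw [ex, Nat.add_mul_div_right _ _ hy0]
    have h3 : 9 * (x % y) / y ≤ 8 := by
      have : 9 * (x % y) / y < 9 := by
        rw [Nat.div_lt_iff_lt_mul hy0]; omega
      omega
    omega
  exact h1.trans h2

/-- **Real sandwich**: `Λ₀(9/8)^m − 1 ≤ Λ_m ≤ Λ₀(9/8)^m`. [folklore] -/
theorem thinR_blocks_real (Λ0 m : ℕ) :
    (Λ0 : ℝ) * (9 / 8) ^ m - 1 ≤ ((Λ0 * 9 ^ m / 8 ^ m : ℕ) : ℝ) ∧ ((Λ0 * 9 ^ m / 8 ^ m : ℕ) : ℝ) ≤ (Λ0 : ℝ) * (9 / 8) ^ m := by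
  have h8 : (0 : ℝ) < (8 : ℝ) ^ m := by positivity
  have e : (Λ0 : ℝ) * (9 / 8) ^ m = ((Λ0 * 9 ^ m : ℕ) : ℝ) / ((8 ^ m : ℕ) : ℝ) := by
    push_cast
    rw [div_pow]; ring
  rw [e]
  constructor
  · have h := Nat.lt_div_mul_add (a := Λ0 * 9 ^ m) (b := 8 ^ m) (by positivity)
    have h' : ((Λ0 * 9 ^ m : ℕ) : ℝ) < ((Λ0 * 9 ^ m / 8 ^ m : ℕ) : ℝ) * ((8 ^ m : ℕ) : ℝ) + ((8 ^ m : ℕ) : ℝ) := by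
      exact_mod_cast h
    have h8' : (0 : ℝ) < ((8 ^ m : ℕ) : ℝ) := by exact_mod_cast (by positivity : 0 < 8 ^ m)
    rw [sub_le_iff_le_add, div_le_iff₀ h8']
    linarith
  · exact Nat.cast_div_le

/-- **Geometric lower bound**: for `Λ₀ ≥ 2`, `Λ_m ≥ (Λ₀/2)(9/8)^m`. [folklore] -/
theorem thinR_blocks_ge_half_geom {Λ0 : ℕ} (hΛ0 : 2 ≤ Λ0) (m : ℕ) :
    (Λ0 : ℝ) / 2 * (9 / 8) ^ m ≤ ((Λ0 * 9 ^ m / 8 ^ m : ℕ) : ℝ) := by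
  have h := (thinR_blocks_real Λ0 m).1
  have hΛ0r : (2 : ℝ) ≤ Λ0 := by exact_mod_cast hΛ0
  have hp : (1 : ℝ) ≤ (9 / 8 : ℝ) ^ m := one_le_pow₀ (by norm_num)
  nlinarith

/-- **Crude upper bound for the rounding allowance**: `Λ_m ≤ Λ₀·2^m`. [folklore] -/
theorem thinR_blocks_le_two_pow (Λ0 m : ℕ) : ((Λ0 * 9 ^ m / 8 ^ m : ℕ) : ℝ) ≤ (Λ0 : ℝ) * 2 ^ m := by
  refine (thinR_blocks_real Λ0 m).2.trans (mul_le_mul_of_nonneg_left ?_ (Nat.cast_nonneg _))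
  exact pow_le_pow_left₀ (by norm_num) (by norm_num) m

/-! ## §2 Window top, separation and cut-off fraction on every block -/

/-- **The window top stays below the shifted class boundary**: `u·⌊θ_nμΛ/(θ_du)⌋ < Λμ` for `θ_n < θ_d`, `0 < μΛ`.
[folklore] -/
theorem thinR_shift {θn θd u μ Λ : ℕ} (hθ : θn < θd) (hμΛ : 0 < Λ * μ) :
    u * (θn * (μ * Λ) / (θd * u)) < Λ * μ := by
  have hθd : 0 < θd := lt_of_le_of_lt (Nat.zero_le _) hθ
  have h1 : u * (θn * (μ * Λ) / (θd * u)) ≤ θn * (μ * Λ) / θd := by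
    rw [mul_comm θd u, ← Nat.div_div_eq_div_mul]
    calc u * (θn * (μ * Λ) / u / θd) ≤ u * (θn * (μ * Λ) / u) / θd := Nat.mul_div_le_mul_div_assoc _ _ _
      _ ≤ θn * (μ * Λ) / θd := Nat.div_le_div_right (Nat.mul_div_le _ _)
  have h2 : θn * (μ * Λ) / θd < Λ * μ := by
    rw [Nat.div_lt_iff_lt_mul hθd]
    have hμΛ' : 0 < μ * Λ := by rwa [mul_comm] at hμΛ
    calc θn * (μ * Λ) < θd * (μ * Λ) := Nat.mul_lt_mul_of_pos_right hθ hμΛ'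
      _ = Λ * μ * θd := by ring
  exact lt_of_le_of_lt h1 h2

/-- **Separation on every block from slope + base**: with `8Λ′ ≤ 9Λ + 8`, `Λ₀ ≤ Λ`, (slope) `9θ_duu′ ≤ 8v′θ_nμ` and (base)
`θ_du(9u′Λ₀ + 8u′ + 8v′) ≤ 8v′θ_nμΛ₀`: `⌊u′Λ′/v′⌋ < ⌊θ_nμΛ/(θ_du)⌋`. [folklore] -/
theorem thinR_sep {u v' u' θn θd μ Λ0 Λ Λ' : ℕ} (hv' : 0 < v') (hθd : 0 < θd) (hu : 0 < u)
    (hsucc : 8 * Λ' ≤ 9 * Λ + 8) (hΛ : Λ0 ≤ Λ)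
    (hslope : 9 * θd * u * u' ≤ 8 * v' * θn * μ) (hbase : θd * u * (9 * u' * Λ0 + 8 * u' + 8 * v') ≤ 8 * v' * θn * μ * Λ0) :
    u' * Λ' / v' < θn * (μ * Λ) / (θd * u) := by
  -- the sufficient condition of `thin_Q₁_lt_Q₂` with `θ_d ↦ θ_du`, `X ↦ μΛ` (as `G * Λ - K` with `K = 0`)
  have key : (θd * u) * (u' * Λ' + v') ≤ v' * θn * (μ * Λ - 0) := by
    rw [Nat.sub_zero]
    have h8 : 8 * ((θd * u) * (u' * Λ' + v')) ≤ 8 * (v' * θn * (μ * Λ)) := by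
      calc 8 * ((θd * u) * (u' * Λ' + v')) = θd * u * (u' * (8 * Λ') + 8 * v') := by ring
        _ ≤ θd * u * (u' * (9 * Λ + 8) + 8 * v') := by gcongr
        _ = θd * u * (9 * u' * Λ0 + 8 * u' + 8 * v') + 9 * θd * u * u' * (Λ - Λ0) := by
            zify [hΛ]; ring
        _ ≤ 8 * v' * θn * μ * Λ0 + 8 * v' * θn * μ * (Λ - Λ0) :=
            Nat.add_le_add hbase (Nat.mul_le_mul_right _ hslope)
        _ = 8 * (v' * θn * (μ * Λ)) := by zify [hΛ]; ring
    exact Nat.le_of_mul_le_mul_left h8 (by norm_num)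
  have := thin_Q₁_lt_Q₂ (u' := u') (v' := v') (θn := θn) (θd := θd * u) (G := μ) (K := 0) (Λ := Λ) (Λ' := Λ') hv'
    (Nat.mul_pos hθd hu) key
  simpa [Nat.sub_zero] using this

/-- **Cut-off fraction on every block from slope + base**: with `8Λ′ ≤ 9Λ + 8`, `Λ₀ ≤ Λ`, (slope) `9θ_duc_du′ ≤ 8c_nv′θ_nμ` and
(base) `θ_duc_du′(9Λ₀ + 8) + 8c_nv′θ_du ≤ 8c_nv′θ_nμΛ₀`: `c_du′Λ′ ≤ c_nv′⌊θ_nμΛ/(θ_du)⌋`. [folklore] -/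
theorem thinR_frac {u v' u' θn θd μ cn cd Λ0 Λ Λ' : ℕ} (hθd : 0 < θd) (hu : 0 < u)
    (hsucc : 8 * Λ' ≤ 9 * Λ + 8) (hΛ : Λ0 ≤ Λ)
    (hslope : 9 * θd * u * cd * u' ≤ 8 * cn * v' * θn * μ)
    (hbase : θd * u * cd * u' * (9 * Λ0 + 8) + 8 * cn * v' * (θd * u) ≤ 8 * cn * v' * θn * μ * Λ0) :
    cd * (u' * Λ') ≤ cn * (v' * (θn * (μ * Λ) / (θd * u))) := by
  set D := θd * u with hD
  have hD0 : 0 < D := Nat.mul_pos hθd hu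
  -- `D·Q₂ ≥ θ_nμΛ − (D − 1)`
  have hfloor : θn * (μ * Λ) < (θn * (μ * Λ) / D) * D + D := Nat.lt_div_mul_add hD0
  -- it suffices that `D·(c_du′Λ′) ≤ c_nv′·(D·Q₂)`
  suffices h : D * (cd * (u' * Λ')) + cn * v' * D ≤ cn * v' * (θn * (μ * Λ)) by
    have h2 : cn * v' * (θn * (μ * Λ)) ≤ cn * v' * ((θn * (μ * Λ) / D) * D + D) := Nat.mul_le_mul_left _ hfloor.le
    have h3 : D * (cd * (u' * Λ')) ≤ D * (cn * (v' * (θn * (μ * Λ) / D))) := by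
      have := h.trans h2
      have e : cn * v' * ((θn * (μ * Λ) / D) * D + D) = D * (cn * (v' * (θn * (μ * Λ) / D))) + cn * v' * D := by ring
      rw [e] at this
      omega
    exact Nat.le_of_mul_le_mul_left h3 hD0
  have h8 : 8 * (D * (cd * (u' * Λ')) + cn * v' * D) ≤ 8 * (cn * v' * (θn * (μ * Λ))) := by
    calc 8 * (D * (cd * (u' * Λ')) + cn * v' * D) = D * cd * u' * (8 * Λ') + 8 * cn * v' * D := by ring
      _ ≤ D * cd * u' * (9 * Λ + 8) + 8 * cn * v' * D := by gcongr
      _ = (θd * u * cd * u' * (9 * Λ0 + 8) + 8 * cn * v' * (θd * u)) + 9 * θd * u * cd * u' * (Λ - Λ0) := by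
          rw [hD]; zify [hΛ]; ring
      _ ≤ 8 * cn * v' * θn * μ * Λ0 + 8 * cn * v' * θn * μ * (Λ - Λ0) :=
          Nat.add_le_add hbase (Nat.mul_le_mul_right _ hslope)
      _ = 8 * (cn * v' * (θn * (μ * Λ))) := by zify [hΛ]; ring
  exact Nat.le_of_mul_le_mul_left h8 (by norm_num)

/-! ## §3 Uniform block constants in the shapes of `…RatioBlocksOsc` -/

/-- **The ratio constant is uniform and at least one**: with `μ = uG − v > 0`, `θ_n < θ_d`, `0 < u`, `1 ≤ Λ`, `Q₂ = ⌊θ_nμΛ/(θ_du)⌋`: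
`0 < ((v+uG)Λ + uQ₂)/((uG−v)Λ − uQ₂)`, `1 ≤ …` and `… ≤ ((v+uG)θ_d + θ_nμ)/((θ_d−θ_n)μ)`. [folklore] -/
theorem thinR_A_facts {u v G θn θd Λ : ℕ} (hu : 0 < u) (hθ : θn < θd) (hvu : v < u * G) (hΛ : 1 ≤ Λ) :
    1 ≤ (((v : ℝ) + u * G) * Λ + u * ((θn * ((u * G - v) * Λ) / (θd * u) : ℕ) : ℝ)) /
        (((u : ℝ) * G - v) * Λ - u * ((θn * ((u * G - v) * Λ) / (θd * u) : ℕ) : ℝ)) ∧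
      (((v : ℝ) + u * G) * Λ + u * ((θn * ((u * G - v) * Λ) / (θd * u) : ℕ) : ℝ)) /
          (((u : ℝ) * G - v) * Λ - u * ((θn * ((u * G - v) * Λ) / (θd * u) : ℕ) : ℝ)) ≤
        (((v : ℝ) + u * G) * θd + θn * ((u * G - v : ℕ) : ℝ)) / (((θd : ℝ) - θn) * ((u * G - v : ℕ) : ℝ)) := by
  set μ := u * G - v with hμ
  set Q : ℕ := θn * (μ * Λ) / (θd * u) with hQ
  have hθd : 0 < θd := lt_of_le_of_lt (Nat.zero_le _) hθ
  have hμ0 : 0 < μ := Nat.sub_pos_of_lt hvu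
  have hur : (0 : ℝ) < u := by exact_mod_cast hu
  have hθdr : (0 : ℝ) < θd := by exact_mod_cast hθd
  have hθr : (θn : ℝ) < θd := by exact_mod_cast hθ
  have hμr : (0 : ℝ) < (μ : ℝ) := by exact_mod_cast hμ0
  have hΛr : (1 : ℝ) ≤ Λ := by exact_mod_cast hΛ
  have eμ : ((u : ℝ) * G - v) = (μ : ℝ) := by
    rw [hμ, Nat.cast_sub hvu.le]; push_cast; ring
  -- `u·Q ≤ θ_nμΛ/θ_d`
  have hQle : (u : ℝ) * (Q : ℝ) ≤ (θn : ℝ) * μ * Λ / θd := by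
    have h1 : ((Q : ℕ) : ℝ) ≤ ((θn * (μ * Λ) : ℕ) : ℝ) / ((θd * u : ℕ) : ℝ) := Nat.cast_div_le
    rw [le_div_iff₀ hθdr]
    have h2 := mul_le_mul_of_nonneg_left h1 (by positivity : (0 : ℝ) ≤ (u : ℝ) * θd)
    have e : (u : ℝ) * θd * (((θn * (μ * Λ) : ℕ) : ℝ) / ((θd * u : ℕ) : ℝ)) = (θn : ℝ) * μ * Λ := by
      push_cast; field_simp
    rw [e] at h2
    linarith
  have hQ0 : (0 : ℝ) ≤ (u : ℝ) * (Q : ℝ) := by positivity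
  have hQle' : (u : ℝ) * (Q : ℝ) * θd ≤ (θn : ℝ) * μ * Λ := (le_div_iff₀ hθdr).mp hQle
  have hΛpos : (0 : ℝ) < Λ := by linarith
  rw [eμ]
  have hden : 0 < (μ : ℝ) * Λ - u * (Q : ℝ) := by
    have h1 : (θn : ℝ) * μ * Λ < θd * (μ * Λ) := by
      have := mul_lt_mul_of_pos_right hθr (mul_pos hμr hΛpos)
      linarith
    have : (θn : ℝ) * μ * Λ / θd < (μ : ℝ) * Λ := by
      rw [div_lt_iff₀ hθdr]; linarith
    linarith
  have hv0 : (0 : ℝ) ≤ v := Nat.cast_nonneg _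
  have hG0 : (0 : ℝ) ≤ (u : ℝ) * G := by positivity
  refine ⟨?_, ?_⟩
  · rw [one_le_div hden]; nlinarith
  · rw [div_le_div_iff₀ hden (by nlinarith)]
    -- cross-multiplied; both sides linear in `uQ` with the right signs
    have hA : ((v : ℝ) + u * G) * Λ + u * (Q : ℝ) ≤ (((v : ℝ) + u * G) * θd + θn * μ) * Λ / θd := by
      rw [le_div_iff₀ hθdr]
      have e : (((v : ℝ) + u * G) * θd + θn * μ) * Λ = ((v : ℝ) + u * G) * Λ * θd + θn * μ * Λ := by ring
      rw [e, add_mul]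
      linarith
    have hB : ((θd : ℝ) - θn) * μ * Λ / θd ≤ (μ : ℝ) * Λ - u * (Q : ℝ) := by
      rw [div_le_iff₀ hθdr]
      have e : ((θd : ℝ) - θn) * μ * Λ = (μ : ℝ) * Λ * θd - θn * μ * Λ := by ring
      rw [e, sub_mul]
      linarith
    have hC : 0 ≤ (((v : ℝ) + u * G) * θd + θn * μ) := by positivity
    have hD : 0 ≤ ((θd : ℝ) - θn) * μ * Λ / θd := by
      have : (0 : ℝ) ≤ (θd : ℝ) - θn := by linarith
      positivity
    calc (((v : ℝ) + u * G) * Λ + u * (Q : ℝ)) * (((θd : ℝ) - θn) * (μ : ℝ))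
        ≤ ((((v : ℝ) + u * G) * θd + θn * μ) * Λ / θd) * (((θd : ℝ) - θn) * (μ : ℝ)) :=
          mul_le_mul_of_nonneg_right hA (by nlinarith)
      _ = (((v : ℝ) + u * G) * θd + θn * μ) * (((θd : ℝ) - θn) * μ * Λ / θd) := by ring
      _ ≤ (((v : ℝ) + u * G) * θd + θn * μ) * ((μ : ℝ) * Λ - u * (Q : ℝ)) := mul_le_mul_of_nonneg_left hB hC

/-- **The block denominators grow geometrically (ratio `9/8`)**: for `Λ₀ ≥ 2`, `Λ_m = ⌊Λ₀9^m/8^m⌋`, `Q₂^m = ⌊θ_nμΛ_m/(θ_du)⌋`: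
`((θ_d − θ_n)μΛ₀/(2θ_du))·(9/8)^m ≤ (μΛ_m − uQ₂^m)/u`. [folklore] -/
theorem thinR_den_ge {u v G θn θd Λ0 : ℕ} (hu : 0 < u) (hθ : θn < θd) (hvu : v < u * G) (hΛ0 : 2 ≤ Λ0) (m : ℕ) :
    ((θd : ℝ) - θn) * ((u * G - v : ℕ) : ℝ) * Λ0 / (2 * θd * u) * (9 / 8) ^ m ≤
      (((u : ℝ) * G - v) * ((Λ0 * 9 ^ m / 8 ^ m : ℕ) : ℝ) -
        u * ((θn * ((u * G - v) * (Λ0 * 9 ^ m / 8 ^ m)) / (θd * u) : ℕ) : ℝ)) / u := by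
  set μ := u * G - v with hμ
  set Λ := Λ0 * 9 ^ m / 8 ^ m with hΛ
  have hθd : 0 < θd := lt_of_le_of_lt (Nat.zero_le _) hθ
  have hμ0 : 0 < μ := Nat.sub_pos_of_lt hvu
  have hur : (0 : ℝ) < u := by exact_mod_cast hu
  have hθdr : (0 : ℝ) < θd := by exact_mod_cast hθd
  have hμr : (0 : ℝ) < (μ : ℝ) := by exact_mod_cast hμ0
  have eμ : ((u : ℝ) * G - v) = (μ : ℝ) := by
    rw [hμ, Nat.cast_sub hvu.le]; push_cast; ring
  have hQle : (u : ℝ) * (((θn * (μ * Λ) / (θd * u) : ℕ) : ℝ)) ≤ (θn : ℝ) * μ * Λ / θd := by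
    have h1 : (((θn * (μ * Λ) / (θd * u) : ℕ)) : ℝ) ≤ ((θn * (μ * Λ) : ℕ) : ℝ) / ((θd * u : ℕ) : ℝ) := Nat.cast_div_le
    rw [le_div_iff₀ hθdr]
    have h2 := mul_le_mul_of_nonneg_left h1 (by positivity : (0 : ℝ) ≤ (u : ℝ) * θd)
    have e : (u : ℝ) * θd * (((θn * (μ * Λ) : ℕ) : ℝ) / ((θd * u : ℕ) : ℝ)) = (θn : ℝ) * μ * Λ := by
      push_cast; field_simp
    rw [e] at h2
    linarith
  have hΛge := thinR_blocks_ge_half_geom hΛ0 m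
  rw [← hΛ] at hΛge
  rw [eμ, le_div_iff₀ hur]
  have h1θ : (0 : ℝ) < (θd : ℝ) - θn := by
    have : (θn : ℝ) < θd := by exact_mod_cast hθ
    linarith
  -- `(μΛ − uQ₂) ≥ (θd−θn)μΛ/θd ≥ (θd−θn)μ(Λ₀/2)(9/8)^m/θd`
  have hQle' : (u : ℝ) * (((θn * (μ * Λ) / (θd * u) : ℕ) : ℝ)) * θd ≤ (θn : ℝ) * μ * Λ := (le_div_iff₀ hθdr).mp hQle
  have h2 : ((θd : ℝ) - θn) * μ * Λ / θd ≤ (μ : ℝ) * Λ - u * (((θn * (μ * Λ) / (θd * u) : ℕ) : ℝ)) := by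
    rw [div_le_iff₀ hθdr]
    have e : ((θd : ℝ) - θn) * μ * Λ = (μ : ℝ) * Λ * θd - θn * μ * Λ := by ring
    rw [e, sub_mul]
    linarith
  have h3 : ((θd : ℝ) - θn) * (μ : ℝ) * Λ0 / (2 * θd * u) * (9 / 8) ^ m * u =
      ((θd : ℝ) - θn) * μ * ((Λ0 : ℝ) / 2 * (9 / 8) ^ m) / θd := by
    field_simp
  rw [h3]
  refine le_trans ?_ h2
  rw [div_le_div_iff_of_pos_right hθdr]
  exact mul_le_mul_of_nonneg_left hΛge (by positivity)

end Summit.AnomalousDissipation.AnomalousDissipation.Theorems.SawtoothPulseCascade.K1Window
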